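/-
Copyright (c) 2026 the pub-hodgecm-mathlib formalisation cell (harness21).  Prover seat hodgecm-mathlib-K2Liu-p01 (g10), Track B «K2-LIT»,
#184♮ = hLiu418 = `stmt-HodgeConjecture-24832`; #42S organ S1 ROAD W: the PARITY LETTER `hopp` of the inert face (★ ED. 4 `K2LiuLocalSWSpanningInertFaceFinal`)
from the #42S END head's `hε` — asked by the S1 producer K2Liu-p08 (g5) 2026-09-05T00:33:50Z for the `hS1ns` dispatch.
-/
import Summits.HodgeConjecture.HodgeConjecture.Theorems.K2LiuGoodPlaceNoDeadLetter                 -- ★ `algebraMap_ne_cmRoot` (+ ★ `hilbertSymbol_eq_neg_one_iff_of_isUnramifiedIn`)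
import Literature.NumberTheory.Automorphic.Liu2021.LemD1AsPrintedIndexedNonVacuityInertCofinite   -- ★ `valued_toPlace_of_isUnramifiedIn`
import Literature.NumberTheory.Automorphic.QuadraticLocalBaseChange                               -- ★ `toPlace`, `toPlace_coe`
import HarnessLib

/-!
# Crux `HLiu418`, #42S-S1 ROAD W: the parity letter `hopp : Odd (vdn₀ + vdn₁)` of the inert face from `(c₁, θ)_v = −1`

Cell `hodgecm-mathlib`, crux item hLiu418 = `stmt-HodgeConjecture-24832` (helper lane `--supports … --as helper`, count-neutral).  THEOREMS ONLY.

WHY.  ★ ED. 4 `K2LiuLocalSWSpanningInertFaceFinal.localDegPS_le_sup_localSWImage_inert_final` takes, besides record-side letters, the `w₀`-valuations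
`vdn₀, vdn₁ : ℕ` of the two frame discriminants `D₀(dV) := −ι(dV 0)·ι(dV 1)·ι(dV 2)` (`hDv± : v_{w₀}(D₀(dV±)) = exp(−vdn±)`) and `hopp : Odd (vdn₀ + vdn₁)`.  In the #42S END
head the second frame is `dV₁ = c₁ • dV₀` (`haV`) with `hε : (c₁, θ)_v = −1`, `θ = cmQuadraticGenerator L`.  At a place `v` UNRAMIFIED in `L = L⁺(√θ)` O'Meara 63:16
(★ `hilbertSymbol_eq_neg_one_iff_of_isUnramifiedIn`) gives `(c₁, θ)_v = −1 ⟺ θ ∉ (L⁺_v)² ∧ ord_v c₁ odd`; since `D₀(c₁ • dV₀) = ι(c₁)³ · D₀(dV₀)` and `ι_{w₀}` preserves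
valuations at an unramified place (★ `valued_toPlace_of_isUnramifiedIn`, ★ `toPlace_coe`), `vdn₁ = vdn₀ − 3·ord_v c₁`, so `vdn₀ + vdn₁ ≡ ord_v c₁ ≡ 1 (mod 2)`.
HEAD **`odd_add_of_hilbertSymbol_eq_neg_one`** — in ★ ED. 4's `hDv±` bytes and the END head's `haV hε` bytes.
References: [Omeara1963] §63C Example 63:16, §65A; [Kudla1994] §3; [KudlaSweet1997] §1.
HONEST LABEL.  Count-neutral helper; `HC_CM` is proved only modulo the 7 printed citations (2 remaining named inputs: hLiu418 = `stmt-HodgeConjecture-24832`,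
h413 = `stmt-HodgeConjecture-24833`) until rung 0 closes.

## References
* [Omeara1963] O. T. O'Meara, *Introduction to Quadratic Forms* (1963), §63C Example 63:16, §65A.
* [Kudla1994] S. S. Kudla, Israel J. Math. 87 (1994), §3.
* [KudlaSweet1997] S. Kudla, W. J. Sweet, Israel J. Math. 98 (1997), §1.
-/

set_option autoImplicit false
set_option linter.dupNamespace false -- the mandated namespace repeats `HodgeConjecture.HodgeConjecture`

noncomputable section

open NumberField NumberField.InfinitePlace IsDedekindDomain
open Literature.NumberTheory.QuadraticForms
open Literature.NumberTheory.Automorphic Literature.NumberTheory.Automorphic.UnitaryGroup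
open Literature.NumberTheory.Automorphic.Liu2021.LemD1IndexedNonVacuityInertCofinite (valued_toPlace_of_isUnramifiedIn)
open Summit.HodgeConjecture.HodgeConjecture.Cruxes.HLiu418.K2LiuGoodPlaceNoDeadLetter (algebraMap_ne_cmRoot)

namespace Summit.HodgeConjecture.HodgeConjecture.Cruxes.HLiu418.K2LiuLocalSWInertFrameParity

variable (L : Type) [Field L] [NumberField L] [IsCMField L]

/-- **THE PARITY LETTER `hopp`.**  At a finite place `v` of `L⁺` unramified in `L`, with `w₀ ∣ v`, for frames `dV₁ = c₁ • dV₀` (`c₁ ∈ (L⁺)ˣ`) whose discriminants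
`D₀(dV) = −ι(dV 0)·ι(dV 1)·ι(dV 2)` have `w₀`-valuations `exp(−vdn₀)`, `exp(−vdn₁)`: if `(c₁, θ)_v = −1` (`θ = cmQuadraticGenerator L`) then `vdn₀ + vdn₁` is odd
(`vdn₁ = vdn₀ + 3·ord c₁`-type bookkeeping with `ord_v c₁` odd by O'Meara 63:16). [cite: Omeara1963, §63C Example 63:16] -/
theorem odd_add_of_hilbertSymbol_eq_neg_one (v : HeightOneSpectrum (𝓞 (maximalRealSubfield L))) (w₀ : PlacesOver L v)
    (hv : Algebra.IsUnramifiedIn (𝓞 L) v.asIdeal) (c₁ : (maximalRealSubfield L)ˣ) (dV₀ dV₁ : Fin 3 → L)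
    (haV : ∀ k, dV₁ k = ((c₁ : maximalRealSubfield L) : L) * dV₀ k)
    (hε : hilbertSymbol (v.adicCompletion (maximalRealSubfield L)) (algebraMap (maximalRealSubfield L) _ ((c₁ : (maximalRealSubfield L)ˣ) : maximalRealSubfield L)) (algebraMap (maximalRealSubfield L) _ (cmQuadraticGenerator L : maximalRealSubfield L)) = -1)
    {vdn₀ vdn₁ : ℕ}
    (hDv₀ : Valued.v (-(algebraMap L (w₀.1.adicCompletion L) (dV₀ 0) * algebraMap L (w₀.1.adicCompletion L) (dV₀ 1) * algebraMap L (w₀.1.adicCompletion L) (dV₀ 2))) =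
      WithZero.exp (-(vdn₀ : ℤ)))
    (hDv₁ : Valued.v (-(algebraMap L (w₀.1.adicCompletion L) (dV₁ 0) * algebraMap L (w₀.1.adicCompletion L) (dV₁ 1) * algebraMap L (w₀.1.adicCompletion L) (dV₁ 2))) =
      WithZero.exp (-(vdn₁ : ℤ))) :
    Odd (vdn₀ + vdn₁) := by
  haveI : Algebra.IsQuadraticExtension (maximalRealSubfield L) L := IsCMField.isQuadraticExtension L
  obtain ⟨α, hα0, hαc, hsq⟩ := cmQuadraticGenerator_spec L
  have hc0 : algebraMap (maximalRealSubfield L) (v.adicCompletion (maximalRealSubfield L)) ((c₁ : (maximalRealSubfield L)ˣ) : maximalRealSubfield L) ≠ 0 := (map_ne_zero _).2 c₁.ne_zero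
  -- O'Meara 63:16 at the unramified place: `(c₁, θ)_v = −1 ⟹ ord_v c₁` odd
  have hodd : Odd (WithZero.log (Valued.v (algebraMap (maximalRealSubfield L) (v.adicCompletion (maximalRealSubfield L)) ((c₁ : (maximalRealSubfield L)ˣ) : maximalRealSubfield L)))) :=
    ((hilbertSymbol_eq_neg_one_iff_of_isUnramifiedIn (maximalRealSubfield L) v hsq (algebraMap_ne_cmRoot L hα0 hαc) hv hc0).1 hε).2
  set n := WithZero.log (Valued.v (algebraMap (maximalRealSubfield L) (v.adicCompletion (maximalRealSubfield L)) ((c₁ : (maximalRealSubfield L)ˣ) : maximalRealSubfield L))) with hn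
  -- `ι_{w₀}` preserves the valuation of `c₁` (unramified)
  have hvc : Valued.v (algebraMap L (w₀.1.adicCompletion L) (((c₁ : (maximalRealSubfield L)ˣ) : maximalRealSubfield L) : L)) = WithZero.exp n := by
    have h1 : algebraMap L (w₀.1.adicCompletion L) (((c₁ : (maximalRealSubfield L)ˣ) : maximalRealSubfield L) : L) =
        toPlace v w₀ (algebraMap (maximalRealSubfield L) (v.adicCompletion (maximalRealSubfield L)) ((c₁ : (maximalRealSubfield L)ˣ) : maximalRealSubfield L)) := (toPlace_coe v w₀ _).symm
    rw [h1, valued_toPlace_of_isUnramifiedIn L v hv w₀, WithZero.exp_log ((Valuation.ne_zero_iff _).2 hc0)]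
  -- `D₀(c₁ • dV₀) = ι(c₁)³ · D₀(dV₀)`
  have hD : -(algebraMap L (w₀.1.adicCompletion L) (dV₁ 0) * algebraMap L (w₀.1.adicCompletion L) (dV₁ 1) * algebraMap L (w₀.1.adicCompletion L) (dV₁ 2)) =
      algebraMap L (w₀.1.adicCompletion L) (((c₁ : (maximalRealSubfield L)ˣ) : maximalRealSubfield L) : L) ^ 3 *
        -(algebraMap L (w₀.1.adicCompletion L) (dV₀ 0) * algebraMap L (w₀.1.adicCompletion L) (dV₀ 1) * algebraMap L (w₀.1.adicCompletion L) (dV₀ 2)) := by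
    simp only [haV, map_mul]; ring
  have key : WithZero.exp (-(vdn₁ : ℤ)) = WithZero.exp n ^ 3 * WithZero.exp (-(vdn₀ : ℤ)) := by rw [← hDv₁, hD, map_mul, map_pow, hvc, hDv₀]
  rw [← zpow_natCast, ← WithZero.exp_zsmul, ← WithZero.exp_add] at key
  have hz := WithZero.exp_injective key
  simp only [smul_eq_mul, Nat.cast_ofNat] at hz
  rw [Int.odd_iff] at hodd
  rw [Nat.odd_iff]
  omega

/-- **the `vdn` letters exist for `w₀`-integral non-zero discriminants** (ED. 2): `x ≠ 0`, `v(x) ≤ 1` ⟹ `v(x) = exp(−n)` for some `n : ℕ` — the `{vdn±} hDv±`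
binders of ★ ED. 4 `K2LiuLocalSWSpanningInertFaceFinal` after the frame rescaling. [cite: CasselsFrohlichANT1967, Ch. II §10] -/
theorem exists_valued_eq_exp_neg_nat {K : Type*} [Field K] [Valued K (WithZero (Multiplicative ℤ))] {x : K} (hx0 : x ≠ 0) (hx : Valued.v x ≤ 1) :
    ∃ n : ℕ, Valued.v x = WithZero.exp (-(n : ℤ)) := by
  have hne : Valued.v x ≠ 0 := (Valuation.ne_zero_iff _).2 hx0
  have hlog : WithZero.log (Valued.v x) ≤ 0 := by
    rw [← WithZero.exp_le_exp, WithZero.exp_log hne, WithZero.exp_zero]; exact hx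
  refine ⟨(-WithZero.log (Valued.v x)).toNat, ?_⟩
  rw [Int.toNat_of_nonneg (by omega), neg_neg, WithZero.exp_log hne]

end Summit.HodgeConjecture.HodgeConjecture.Cruxes.HLiu418.K2LiuLocalSWInertFrameParity

end
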